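import Literature.Barriers.BirchSwinnertonDyer.RankNotSumOfLocalInvariantsF4Field
import Mathlib.NumberTheory.NumberField.InfinitePlace.TotallyRealComplex
import Mathlib.RingTheory.Ideal.Pointwise
import Mathlib.Tactic.ComputeDegree
import HarnessLib

/-!
# Places of `F₄ = ℚ(√-1, √41, √73)` (Dokchitser–Dokchitser 2011, proof of Theorem 2), I

Continuation of `RankNotSumOfLocalInvariantsF4Field.lean` (the concrete model
`DokchitserDokchitser2011.F4` of `F₄`). The source asserts that "`F₄` [satisfies] the
assumptions of Lemma 3 with `n = 4`", i.e. the number of places of `F₄` above each place of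
`ℚ` is a multiple of `4` [DokchitserDokchitser2011RankModN, proof of Thm. 2]. This file proves
the INFINITE part and prepares the finite part:

* `F4.isTotallyComplex`, `F4.card_infinitePlace` (`= 4`), `F4.four_dvd_card_infinitePlace`:
  `F4 ∋ √-1` has no real place, so `4 = 8/2` complex places lie over the place `∞` of `ℚ`.
* The **residue trick** (`smul_ne_sub_of_mem`): if a ring automorphism `ρ` stabilises a prime
  `P`, `θ` satisfies `(θ - m)(θ - (t - m)) ∈ P` and `2m - t ∉ P` (the two roots `m`, `t - m` of
  `X² - tX + n` are distinct modulo `P`), then `ρ θ ≠ t - θ`. This is the elementary content of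
  "`e = f = 1` at a prime where the minimal polynomial has distinct roots mod `p`", in a form
  that needs neither the ring of integers of `F₄` nor Kummer–Dedekind.
* The algebraic integers `intA = √-1`, `intB = √41`, `intC = √73`, `intTheta = (1 + √41)/2`,
  `intEta = (1 + √73)/2` of `F4`, and, for a prime `P` of `𝓞 F4` and `ρ ∈ Gal(F4/ℚ)` with
  `ρ • P = P`: if `2 ∈ P` then `ρ` fixes `√41` and `√73` (`θ(θ - 1) = 10`, `η(η - 1) = 18`);
  if `41 ∈ P` then `ρ` fixes `√-1 ≡ ±9` and `√73 ≡ ±14`; if `73 ∈ P` then `ρ` fixes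
  `√-1 ≡ ±27` and `√41 ≡ ±25` (`F4.apply_*_of_*_mem`); and if `2, 41, 73 ∉ P` then an element
  of the inertia group (`ρ x - x ∈ P` for all `x`) is trivial (`F4.eq_one_of_inertia`:
  otherwise `ρ` negates some `δ ∈ {√-1, √41, √73}`, whence `2δ ∈ P` and `4δ² ∈ P`).

The count of the finite places (`4 ∣ #{w ∣ v}`) and the reduction of the named fact
`DokchitserDokchitser2011_rank_480a1_F4` to the Magma rank computation are in
`RankNotSumOfLocalInvariantsF4Descent.lean`. Everything here is elementary and [folklore]; the
field and the claim are from the source.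

## References

* T. Dokchitser, V. Dokchitser, *A note on the Mordell–Weil rank modulo `n`*, J. Number Theory
  131 (2011) 1833–1839, arXiv:0910.4588, Lemma 3 and proof of Thm. 2.
  [DokchitserDokchitser2011RankModN]
-/

noncomputable section

open QuadraticAlgebra

namespace Literature.Barriers.BirchSwinnertonDyer.DokchitserDokchitser2011

open NumberField InfinitePlace

/-- `F4 ∋ √-1` is totally complex: a real embedding would send `√-1` to a real number of
square `-1`. [folklore] -/
instance F4.isTotallyComplex : IsTotallyComplex F4 where
  isComplex w := by
    rw [← not_isReal_iff_isComplex, InfinitePlace.isReal_iff, ComplexEmbedding.isReal_iff]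
    intro h
    have h1 : starRingEnd ℂ (w.embedding F4.rtm1) = w.embedding F4.rtm1 := by
      have := RingHom.congr_fun h F4.rtm1
      rwa [ComplexEmbedding.conjugate_coe_eq] at this
    have h2 : w.embedding F4.rtm1 * w.embedding F4.rtm1 = -1 := by
      rw [← map_mul, F4.rtm1_mul_self, map_neg, map_one]
    have him : (w.embedding F4.rtm1).im = 0 := Complex.conj_eq_iff_im.mp h1
    have hre := congrArg Complex.re h2
    simp only [Complex.mul_re, him, mul_zero, sub_zero, Complex.neg_re, Complex.one_re] at hre
    nlinarith [mul_self_nonneg (w.embedding F4.rtm1).re]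

/-- `F4` has exactly `4` infinite places (all complex). [folklore] -/
theorem F4.card_infinitePlace : Fintype.card (InfinitePlace F4) = 4 := by
  have h := IsTotallyComplex.finrank (K := F4)
  rw [F4.finrank_eq] at h
  rw [card_eq_nrRealPlaces_add_nrComplexPlaces, IsTotallyComplex.nrRealPlaces_eq_zero]
  omega

/-- Over the (unique) infinite place of `ℚ` lie `4` places of `F4`; in particular their number
is a multiple of `4`. [folklore] -/
theorem F4.four_dvd_card_infinitePlace (v : InfinitePlace ℚ) :
    4 ∣ Nat.card {w : InfinitePlace F4 // w.comap (algebraMap ℚ F4) = v} := by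
  have e : Nat.card {w : InfinitePlace F4 // w.comap (algebraMap ℚ F4) = v} =
      Nat.card (InfinitePlace F4) :=
    Nat.card_congr (Equiv.subtypeUnivEquiv fun w => Subsingleton.elim _ _)
  rw [e, Nat.card_eq_fintype_card, F4.card_infinitePlace]


/-! ## Finite places: the residue trick and the algebraic integers used -/

open NumberField IsDedekindDomain Polynomial
open scoped Pointwise

section ResidueTrick

variable {B G : Type*} [CommRing B] [Group G] [MulSemiringAction G B]

/-- A ring automorphism fixes the integers. [folklore] -/
theorem smul_intCast_eq (g : G) (n : ℤ) : g • (n : B) = n := by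
  rw [← MulSemiringAction.toRingHom_apply G B g, map_intCast]

/-- **Residue trick.** Let `G` act on `B` by ring automorphisms, `P` a prime ideal with
`ρ • P = P`, and `θ ∈ B` with `(θ - m)(θ - (t - m)) ∈ P` ("`θ ≡ m` or `θ ≡ t - m (mod P)`",
two roots of `X² - tX + n` modulo `P`) where `2m - t ∉ P` (the two roots are distinct mod `P`).
Then `ρ θ ≠ t - θ`: `ρ` cannot swap the two roots. (Proof: if `θ - m ∈ P` then
`ρ(θ - m) = t - θ - m ∈ P` and the sum `t - 2m ∈ P`; symmetrically in the other case.)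
[folklore] -/
theorem smul_ne_sub_of_mem {P : Ideal B} [P.IsPrime] {ρ : G} (hρ : ρ • P = P) {θ : B} {t m : ℤ}
    (hm : (θ - m) * (θ - (t - m)) ∈ P) (h2 : ((2 * m - t : ℤ) : B) ∉ P) :
    ρ • θ ≠ (t : B) - θ := by
  intro hθ
  have hmem : ∀ x ∈ P, ρ • x ∈ P := fun x hx => by
    rw [← hρ]
    exact Ideal.smul_mem_pointwise_smul ρ x P hx
  apply h2
  rcases Ideal.IsPrime.mem_or_mem ‹_› hm with h | h
  · have h' := hmem _ h
    rw [smul_sub, hθ, smul_intCast_eq] at h'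
    have := P.neg_mem (P.add_mem h h')
    convert this using 1
    push_cast
    ring
  · have h' := hmem _ h
    rw [smul_sub, hθ, smul_sub, smul_intCast_eq, smul_intCast_eq] at h'
    have := P.add_mem h h'
    convert this using 1
    push_cast
    ring

end ResidueTrick

/-- `√-1` as an algebraic integer of `F4`. [folklore] -/
def F4.intA : 𝓞 F4 :=
  ⟨F4.rtm1, show IsIntegral ℤ F4.rtm1 from
    ⟨X ^ 2 + C 1, monic_X_pow_add_C 1 two_ne_zero, by simp [eval₂_add]⟩⟩

/-- `√41` as an algebraic integer of `F4`. [folklore] -/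
def F4.intB : 𝓞 F4 :=
  ⟨F4.rt41, show IsIntegral ℤ F4.rt41 from
    ⟨X ^ 2 - C 41, monic_X_pow_sub_C 41 two_ne_zero, by simp [eval₂_sub]⟩⟩

/-- `√73` as an algebraic integer of `F4`. [folklore] -/
def F4.intC : 𝓞 F4 :=
  ⟨F4.rt73, show IsIntegral ℤ F4.rt73 from
    ⟨X ^ 2 - C 73, monic_X_pow_sub_C 73 two_ne_zero, by simp [eval₂_sub]⟩⟩

/-- `(1 + √41)/2` is an algebraic integer of `F4` (root of `X² - X - 10`). [folklore] -/
def F4.intTheta : 𝓞 F4 :=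
  ⟨(1 + F4.rt41) / 2, show IsIntegral ℤ ((1 + F4.rt41) / 2) from
    ⟨X ^ 2 - X - C 10, by monicity!, by
      simp only [eval₂_sub, eval₂_X_pow, eval₂_X, eval₂_ofNat, map_ofNat]
      linear_combination (1 / 4 : F4) * F4.rt41_mul_self⟩⟩

/-- `(1 + √73)/2` is an algebraic integer of `F4` (root of `X² - X - 18`). [folklore] -/
def F4.intEta : 𝓞 F4 :=
  ⟨(1 + F4.rt73) / 2, show IsIntegral ℤ ((1 + F4.rt73) / 2) from
    ⟨X ^ 2 - X - C 18, by monicity!, by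
      simp only [eval₂_sub, eval₂_X_pow, eval₂_X, eval₂_ofNat, map_ofNat]
      linear_combination (1 / 4 : F4) * F4.rt73_mul_self⟩⟩

/-- The algebraic integer `F4.intA` is `√-1`. [folklore] -/
@[simp] theorem F4.coe_intA : (F4.intA : F4) = F4.rtm1 := rfl
/-- The algebraic integer `F4.intB` is `√41`. [folklore] -/
@[simp] theorem F4.coe_intB : (F4.intB : F4) = F4.rt41 := rfl
/-- The algebraic integer `F4.intC` is `√73`. [folklore] -/
@[simp] theorem F4.coe_intC : (F4.intC : F4) = F4.rt73 := rfl
/-- The algebraic integer `F4.intTheta` is `(1 + √41)/2`. [folklore] -/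
@[simp] theorem F4.coe_intTheta : (F4.intTheta : F4) = (1 + F4.rt41) / 2 := by
  simp only [F4.intTheta, RingOfIntegers.map_mk]
/-- The algebraic integer `F4.intEta` is `(1 + √73)/2`. [folklore] -/
@[simp] theorem F4.coe_intEta : (F4.intEta : F4) = (1 + F4.rt73) / 2 := by
  simp only [F4.intEta, RingOfIntegers.map_mk]

/-- The action of `σ ∈ Gal(F4/ℚ)` on `𝓞 F4` is the restriction of `σ`. [folklore] -/
theorem F4.coe_smul (σ : F4 ≃ₐ[ℚ] F4) (x : 𝓞 F4) : ((σ • x : 𝓞 F4) : F4) = σ (x : F4) := rfl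



section Generic

variable {B G : Type*} [CommRing B] [Group G] [MulSemiringAction G B]

/-- Residue trick, the case `t = 0`: if `(δ - m)(δ + m) ∈ P` and `2m ∉ P` then no `ρ` stabilising
`P` negates `δ`. [folklore] -/
theorem smul_ne_neg_of_mem {P : Ideal B} [P.IsPrime] {ρ : G} (hρ : ρ • P = P) {δ : B} {m : ℤ}
    (hm : (δ - m) * (δ + m) ∈ P) (h2 : ((2 * m : ℤ) : B) ∉ P) : ρ • δ ≠ -δ := by
  have h := smul_ne_sub_of_mem hρ (θ := δ) (t := 0) (m := m) (by simpa using hm) (by simpa using h2)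
  simpa using h

/-- Bezout: if `p ∈ P ≠ ⊤` and `u n + v p = 1` then `n ∉ P`. [folklore] -/
theorem not_mem_of_bezout {P : Ideal B} (hP : P ≠ ⊤) {p n : B} (hp : p ∈ P) (u v : B)
    (h : u * n + v * p = 1) : n ∉ P := fun hn =>
  hP ((Ideal.eq_top_iff_one P).mpr (h ▸ P.add_mem (P.mul_mem_left u hn) (P.mul_mem_left v hp)))

/-- A subgroup in which any two non-identity elements coincide has at most two elements.
[folklore] -/
theorem Subgroup.card_le_two_of {H : Subgroup G}
    (h : ∀ σ ∈ H, ∀ τ ∈ H, σ ≠ 1 → τ ≠ 1 → σ = τ) : Nat.card H ≤ 2 := by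
  classical
  let f : H → Bool := fun x => decide (x = 1)
  have hf : Function.Injective f := by
    intro x y hxy
    by_cases hx : x = 1 <;> by_cases hy : y = 1
    · rw [hx, hy]
    · simp [f, hx, hy] at hxy
    · simp [f, hx, hy] at hxy
    · exact Subtype.ext (h x x.2 y y.2 (fun e => hx (Subtype.ext e)) (fun e => hy (Subtype.ext e)))
  simpa using Nat.card_le_card_of_injective f hf

end Generic

section Stabilizer

variable {P : Ideal (𝓞 F4)} [P.IsPrime] {ρ : F4 ≃ₐ[ℚ] F4}

/-- If `ρ(√-1) = -√-1` then `ρ` negates the algebraic integer `intA`. [folklore] -/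
theorem F4.smul_intA_of_neg (h : ρ F4.rtm1 = -F4.rtm1) : ρ • F4.intA = -F4.intA :=
  RingOfIntegers.ext (by simp only [F4.coe_smul, F4.coe_intA, h, map_neg])

/-- If `ρ(√41) = -√41` then `ρ` negates the algebraic integer `intB`. [folklore] -/
theorem F4.smul_intB_of_neg (h : ρ F4.rt41 = -F4.rt41) : ρ • F4.intB = -F4.intB :=
  RingOfIntegers.ext (by simp only [F4.coe_smul, F4.coe_intB, h, map_neg])

/-- If `ρ(√73) = -√73` then `ρ` negates the algebraic integer `intC`. [folklore] -/
theorem F4.smul_intC_of_neg (h : ρ F4.rt73 = -F4.rt73) : ρ • F4.intC = -F4.intC :=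
  RingOfIntegers.ext (by simp only [F4.coe_smul, F4.coe_intC, h, map_neg])

/-- If `ρ(√41) = -√41` then `ρ θ = 1 - θ` for `θ = (1 + √41)/2`. [folklore] -/
theorem F4.smul_intTheta_of_neg (h : ρ F4.rt41 = -F4.rt41) :
    ρ • F4.intTheta = ((1 : ℤ) : 𝓞 F4) - F4.intTheta := by
  apply RingOfIntegers.ext
  simp only [F4.coe_smul, map_sub, map_intCast, F4.coe_intTheta, map_div₀, map_add, map_one, h,
    map_ofNat]
  push_cast
  ring

/-- If `ρ(√73) = -√73` then `ρ η = 1 - η` for `η = (1 + √73)/2`. [folklore] -/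
theorem F4.smul_intEta_of_neg (h : ρ F4.rt73 = -F4.rt73) :
    ρ • F4.intEta = ((1 : ℤ) : 𝓞 F4) - F4.intEta := by
  apply RingOfIntegers.ext
  simp only [F4.coe_smul, map_sub, map_intCast, F4.coe_intEta, map_div₀, map_add, map_one, h,
    map_ofNat]
  push_cast
  ring

/-- `p = 2`: every `ρ` stabilising a prime `P ∋ 2` fixes `√41` (as `θ = (1+√41)/2` satisfies
`θ(θ-1) = 10 ∈ P` with distinct roots `0, 1` mod `P`). [folklore] -/
theorem F4.apply_rt41_of_two_mem (h2 : (2 : 𝓞 F4) ∈ P) (hρ : ρ • P = P) : ρ F4.rt41 = F4.rt41 := by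
  refine (F4.algEquiv_rt41 ρ).resolve_right fun h => ?_
  refine smul_ne_sub_of_mem hρ (θ := F4.intTheta) (t := 1) (m := 0) ?_ ?_ (F4.smul_intTheta_of_neg h)
  · have e : (F4.intTheta - (0 : ℤ)) * (F4.intTheta - ((1 : ℤ) - (0 : ℤ))) = 2 * 5 := by
      apply RingOfIntegers.ext
      simp only [map_mul, map_sub, map_intCast, map_ofNat, F4.coe_intTheta]
      push_cast
      linear_combination (1 / 4 : F4) * F4.rt41_mul_self
    rw [e]
    exact P.mul_mem_right _ h2
  · intro hm
    apply ‹P.IsPrime›.ne_top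
    rw [Ideal.eq_top_iff_one]
    have := P.neg_mem hm
    convert this using 1
    push_cast
    ring

/-- `p = 2`: every `ρ` stabilising a prime `P ∋ 2` fixes `√73`. [folklore] -/
theorem F4.apply_rt73_of_two_mem (h2 : (2 : 𝓞 F4) ∈ P) (hρ : ρ • P = P) : ρ F4.rt73 = F4.rt73 := by
  refine (F4.algEquiv_rt73 ρ).resolve_right fun h => ?_
  refine smul_ne_sub_of_mem hρ (θ := F4.intEta) (t := 1) (m := 0) ?_ ?_ (F4.smul_intEta_of_neg h)
  · have e : (F4.intEta - (0 : ℤ)) * (F4.intEta - ((1 : ℤ) - (0 : ℤ))) = 2 * 9 := by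
      apply RingOfIntegers.ext
      simp only [map_mul, map_sub, map_intCast, map_ofNat, F4.coe_intEta]
      push_cast
      linear_combination (1 / 4 : F4) * F4.rt73_mul_self
    rw [e]
    exact P.mul_mem_right _ h2
  · intro hm
    apply ‹P.IsPrime›.ne_top
    rw [Ideal.eq_top_iff_one]
    have := P.neg_mem hm
    convert this using 1
    push_cast
    ring

/-- `p = 41`: every `ρ` stabilising a prime `P ∋ 41` fixes `√-1` (`√-1 ≡ ±9 mod P`, `18 ∉ P`).
[folklore] -/
theorem F4.apply_rtm1_of_41_mem (h41 : (41 : 𝓞 F4) ∈ P) (hρ : ρ • P = P) :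
    ρ F4.rtm1 = F4.rtm1 := by
  refine (F4.algEquiv_rtm1 ρ).resolve_right fun h => ?_
  refine smul_ne_neg_of_mem hρ (δ := F4.intA) (m := 9) ?_ ?_ (F4.smul_intA_of_neg h)
  · have e : (F4.intA - (9 : ℤ)) * (F4.intA + (9 : ℤ)) = 41 * (-2) := by
      apply RingOfIntegers.ext
      simp only [map_mul, map_sub, map_add, map_intCast, map_ofNat, map_neg, F4.coe_intA]
      push_cast
      linear_combination F4.rtm1_mul_self
    rw [e]
    exact P.mul_mem_right _ h41
  · exact not_mem_of_bezout ‹P.IsPrime›.ne_top h41 16 (-7) (by push_cast; norm_num)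

end Stabilizer



section Stabilizer2

variable {P : Ideal (𝓞 F4)} [P.IsPrime] {ρ : F4 ≃ₐ[ℚ] F4}

/-- `p = 41`: every `ρ` stabilising a prime `P ∋ 41` fixes `√73` (`√73 ≡ ±14 mod P`, `28 ∉ P`).
[folklore] -/
theorem F4.apply_rt73_of_41_mem (h41 : (41 : 𝓞 F4) ∈ P) (hρ : ρ • P = P) :
    ρ F4.rt73 = F4.rt73 := by
  refine (F4.algEquiv_rt73 ρ).resolve_right fun h => ?_
  refine smul_ne_neg_of_mem hρ (δ := F4.intC) (m := 14) ?_ ?_ (F4.smul_intC_of_neg h)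
  · have e : (F4.intC - (14 : ℤ)) * (F4.intC + (14 : ℤ)) = 41 * (-3) := by
      apply RingOfIntegers.ext
      simp only [map_mul, map_sub, map_add, map_intCast, map_ofNat, map_neg, F4.coe_intC]
      push_cast
      linear_combination F4.rt73_mul_self
    rw [e]
    exact P.mul_mem_right _ h41
  · exact not_mem_of_bezout ‹P.IsPrime›.ne_top h41 22 (-15) (by push_cast; norm_num)

/-- `p = 73`: every `ρ` stabilising a prime `P ∋ 73` fixes `√-1` (`√-1 ≡ ±27 mod P`, `54 ∉ P`).
[folklore] -/
theorem F4.apply_rtm1_of_73_mem (h73 : (73 : 𝓞 F4) ∈ P) (hρ : ρ • P = P) :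
    ρ F4.rtm1 = F4.rtm1 := by
  refine (F4.algEquiv_rtm1 ρ).resolve_right fun h => ?_
  refine smul_ne_neg_of_mem hρ (δ := F4.intA) (m := 27) ?_ ?_ (F4.smul_intA_of_neg h)
  · have e : (F4.intA - (27 : ℤ)) * (F4.intA + (27 : ℤ)) = 73 * (-10) := by
      apply RingOfIntegers.ext
      simp only [map_mul, map_sub, map_add, map_intCast, map_ofNat, map_neg, F4.coe_intA]
      push_cast
      linear_combination F4.rtm1_mul_self
    rw [e]
    exact P.mul_mem_right _ h73
  · exact not_mem_of_bezout ‹P.IsPrime›.ne_top h73 23 (-17) (by push_cast; norm_num)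

/-- `p = 73`: every `ρ` stabilising a prime `P ∋ 73` fixes `√41` (`√41 ≡ ±25 mod P`, `50 ∉ P`).
[folklore] -/
theorem F4.apply_rt41_of_73_mem (h73 : (73 : 𝓞 F4) ∈ P) (hρ : ρ • P = P) :
    ρ F4.rt41 = F4.rt41 := by
  refine (F4.algEquiv_rt41 ρ).resolve_right fun h => ?_
  refine smul_ne_neg_of_mem hρ (δ := F4.intB) (m := 25) ?_ ?_ (F4.smul_intB_of_neg h)
  · have e : (F4.intB - (25 : ℤ)) * (F4.intB + (25 : ℤ)) = 73 * (-8) := by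
      apply RingOfIntegers.ext
      simp only [map_mul, map_sub, map_add, map_intCast, map_ofNat, map_neg, F4.coe_intB]
      push_cast
      linear_combination F4.rt41_mul_self
    rw [e]
    exact P.mul_mem_right _ h73
  · exact not_mem_of_bezout ‹P.IsPrime›.ne_top h73 19 (-13) (by push_cast; norm_num)

/-- Away from `2, 41, 73` the inertia is trivial: if `ρ x - x ∈ P` for all `x ∈ 𝓞 F4` and
`2, 41, 73 ∉ P`, then `ρ = 1` (a non-trivial `ρ` negates `δ ∈ {√-1, √41, √73}`, giving
`2δ ∈ P`, `4δ² ∈ P`). [folklore] -/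
theorem F4.eq_one_of_inertia (h2 : (2 : 𝓞 F4) ∉ P) (h41 : (41 : 𝓞 F4) ∉ P)
    (h73 : (73 : 𝓞 F4) ∉ P) (hρ : ∀ x : 𝓞 F4, ρ • x - x ∈ P) : ρ = 1 := by
  have key : ∀ (δ : 𝓞 F4) (d : 𝓞 F4), δ * δ = d → ρ • δ = -δ → 2 * 2 * d ∈ P := by
    intro δ d hd hneg
    have h1 : ρ • δ - δ ∈ P := hρ δ
    rw [hneg] at h1
    have h3 := P.mul_mem_left (-δ - δ) h1
    convert h3 using 1
    rw [← hd]
    ring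
  have hP := ‹P.IsPrime›
  apply F4.algEquiv_eq_one
  · refine (F4.algEquiv_rtm1 ρ).resolve_right fun h => ?_
    have := key F4.intA (-1) (RingOfIntegers.ext (by simp [map_mul, map_neg, map_one])) (F4.smul_intA_of_neg h)
    rw [mul_neg, mul_one] at this
    rcases hP.mem_or_mem (P.neg_mem_iff.mp this) with h' | h' <;> exact h2 h'
  · refine (F4.algEquiv_rt41 ρ).resolve_right fun h => ?_
    have := key F4.intB 41 (RingOfIntegers.ext (by simp [map_mul, map_ofNat])) (F4.smul_intB_of_neg h)
    rcases hP.mem_or_mem this with h' | h'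
    · rcases hP.mem_or_mem h' with h'' | h'' <;> exact h2 h''
    · exact h41 h'
  · refine (F4.algEquiv_rt73 ρ).resolve_right fun h => ?_
    have := key F4.intC 73 (RingOfIntegers.ext (by simp [map_mul, map_ofNat])) (F4.smul_intC_of_neg h)
    rcases hP.mem_or_mem this with h' | h'
    · rcases hP.mem_or_mem h' with h'' | h'' <;> exact h2 h''
    · exact h73 h'

end Stabilizer2


end Literature.Barriers.BirchSwinnertonDyer.DokchitserDokchitser2011

end
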